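import Literature.NumberTheory.Irrationality.Zudilin2003.ZetaFourTelescoping
import HarnessLib

/-!
# Zudilin 2003 (JTNB), §2: the derivative of the summand `R_n`, its order at infinity, and the series `F_n`

Topic `Literature/NumberTheory/Irrationality/Zudilin2003`, sub-namespace `ZetaFour` (objects of
`ZetaFourRecursion.lean`: `R n t` (10), `F n = −Σ_{t≥1} R_n'(t)` (11); blocks `Ablock/Bblock/Cblock` of
`ZetaFourTelescoping.lean`). Source: W. Zudilin, *Well-poised hypergeometric service for diophantine problems of
zeta values*, J. Théor. Nombres Bordeaux **15** (2003) 593–626 [Zudilin2003WellPoised], §2, READ ON THE PAGE (held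
text `paper:galaxy-pdf-1593531969313998860`, p0005–p0006): the series (11) `F_n := −Σ_{t=1}^{∞} R_n'(t)` and, in
the proof of Lemma 3, "Since `R_n(t) = O(t^{−3})` … as `t → ∞` for `n ≥ 1` … both functions `R_n(t)` and
`S_n(t) = s_n(t)R_n(t)` have second-order zero at `t = 1`."

## What is proved (no named facts)

Elementary real analysis of the printed rational function (10), as groundwork for Lemma 3 and the limit (7):
* `hasDerivAt_Ablock` etc.: derivatives of the factor blocks (`Ad`, `Bd`, `Cd` = the raw sums of products over
  one omitted factor), the quotient `G_n = A_nB_n/C_n²` (`Gblock`, `R_eq_G : R_n = (−1)ⁿ(2t+n)G_n²`) and its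
  derivative `Gd` (`hasDerivAt_Gblock`), and `R_n' = Rd := (−1)ⁿ(2G_n² + 2(2t+n)G_nG_n')` at every real `t > 0`
  (`hasDerivAt_R`);
* the double zeros: `G_n = R_n = R_n' = 0` at the integers `1 ≤ t ≤ n` (`Gblock_natCast_eq_zero`,
  `R_natCast_eq_zero`, `deriv_R_natCast_eq_zero`);
* the order at infinity, uniformly in `n`: for real `t ≥ n+1`, `0 ≤ G_n(t) ≤ 1/t²` (pairing
  `(t−j)(t+n+j) ≤ (t+j)(t+n+1−j)`), `|R_n(t)| ≤ 3/t³`, `|G_n'(t)| ≤ G_n(t)(4n+2)/(t−n)`,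
  `|R_n'(t)| ≤ 2/t⁴ + 6(4n+2)/(t³(t−n))` (`Gblock_le`, `abs_R_le`, `abs_Gd_le`, `abs_Rd_le`); at the integers
  `t = n+1+m`: `|R_n'(t)| ≤ (24n+14)/(m+1)⁴` (`abs_deriv_R_le`);
* hence (11) converges absolutely: `summable_deriv_R`, `hasSum_F` (`HasSum (m ↦ −R_n'(m+1)) (F n)`), and the
  polynomial bound **`abs_F_le : |F_n| ≤ 72n + 42`** (from `Σ_{m≥0}(m+1)^{−4} = π⁴/90 < 3`), the input for
  `F_n/u_n → 0` (`u_n ≥ 12ⁿ`, `ZetaFourRates.lean`).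

HONEST FRAMING (cell zeta5-irr): real-analysis bookkeeping for a printed construction; nothing about `ζ(5)`;
no rung moves.
-/

noncomputable section

open Finset Filter Topology
open scoped Nat

namespace Literature.NumberTheory.Irrationality.Zudilin2003.ZetaFour

/-! ### The quotient `G_n = A_nB_n/C_n²` and the raw derivatives of the blocks -/

/-- `G_n(t) = A_n(t)B_n(t)/C_n(t)²`, so that `R_n = (−1)ⁿ(2t+n)G_n²`. [cite: Zudilin2003WellPoised, §2 eq. (10)] -/
def Gblock (n : ℕ) (t : ℝ) : ℝ := Ablock n t * Bblock n t / Cblock n t ^ 2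

/-- `R_n = (−1)ⁿ(2t+n)G_n²`. [cite: Zudilin2003WellPoised, §2 eq. (10)] -/
theorem R_eq_G (n : ℕ) (t : ℝ) : R n t = (-1) ^ n * (2 * t + n) * Gblock n t ^ 2 := by
  rw [R_eq_blocks]; rfl

/-- `A_n'(t) = Σ_i ∏_{j≠i}(t−j−1)`. [cite: Zudilin2003WellPoised, §2 eq. (11)] -/
def Ad (n : ℕ) (t : ℝ) : ℝ := ∑ i ∈ range n, ∏ j ∈ (range n).erase i, (t - ((j : ℝ) + 1))

/-- `B_n'(t) = Σ_i ∏_{j≠i}(t+n+j+1)`. [cite: Zudilin2003WellPoised, §2 eq. (11)] -/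
def Bd (n : ℕ) (t : ℝ) : ℝ := ∑ i ∈ range n, ∏ j ∈ (range n).erase i, (t + n + ((j : ℝ) + 1))

/-- `C_n'(t) = Σ_i ∏_{j≠i}(t+j)`. [cite: Zudilin2003WellPoised, §2 eq. (11)] -/
def Cd (n : ℕ) (t : ℝ) : ℝ := ∑ i ∈ range (n + 1), ∏ j ∈ (range (n + 1)).erase i, (t + (j : ℝ))

/-- `G_n' = ((A'B + AB')C² − AB·2CC')/C⁴` (quotient rule). [cite: Zudilin2003WellPoised, §2 eq. (11)] -/
def Gd (n : ℕ) (t : ℝ) : ℝ :=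
  ((Ad n t * Bblock n t + Ablock n t * Bd n t) * Cblock n t ^ 2 -
      Ablock n t * Bblock n t * (2 * Cblock n t * Cd n t)) / (Cblock n t ^ 2) ^ 2

/-- `R_n' = (−1)ⁿ(2G_n² + (2t+n)·2G_nG_n')`. [cite: Zudilin2003WellPoised, §2 eq. (11)] -/
def Rd (n : ℕ) (t : ℝ) : ℝ :=
  (-1) ^ n * (2 * Gblock n t ^ 2 + (2 * t + n) * (2 * Gblock n t * Gd n t))

/-- `A_n` is differentiable with derivative `Ad`. [cite: Zudilin2003WellPoised, §2 eq. (11)] -/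
theorem hasDerivAt_Ablock (n : ℕ) (t : ℝ) : HasDerivAt (Ablock n) (Ad n t) t := by
  have h : ∀ i ∈ range n, HasDerivAt (fun t : ℝ => t - ((i : ℝ) + 1)) 1 t :=
    fun i _ => (hasDerivAt_id t).sub_const _
  have := HasDerivAt.fun_finsetProd h
  simp only [smul_eq_mul, mul_one] at this
  exact this

/-- `B_n` is differentiable with derivative `Bd`. [cite: Zudilin2003WellPoised, §2 eq. (11)] -/
theorem hasDerivAt_Bblock (n : ℕ) (t : ℝ) : HasDerivAt (Bblock n) (Bd n t) t := by
  have h : ∀ i ∈ range n, HasDerivAt (fun t : ℝ => t + n + ((i : ℝ) + 1)) 1 t :=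
    fun i _ => ((hasDerivAt_id t).add_const (n : ℝ)).add_const _
  have := HasDerivAt.fun_finsetProd h
  simp only [smul_eq_mul, mul_one] at this
  exact this

/-- `C_n` is differentiable with derivative `Cd`. [cite: Zudilin2003WellPoised, §2 eq. (11)] -/
theorem hasDerivAt_Cblock (n : ℕ) (t : ℝ) : HasDerivAt (Cblock n) (Cd n t) t := by
  have h : ∀ i ∈ range (n + 1), HasDerivAt (fun t : ℝ => t + (i : ℝ)) 1 t :=
    fun i _ => (hasDerivAt_id t).add_const _
  have := HasDerivAt.fun_finsetProd h
  simp only [smul_eq_mul, mul_one] at this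
  exact this

/-- `G_n` is differentiable at `t > 0` with derivative `Gd`. [cite: Zudilin2003WellPoised, §2 eq. (11)] -/
theorem hasDerivAt_Gblock (n : ℕ) {t : ℝ} (ht : 0 < t) : HasDerivAt (Gblock n) (Gd n t) t := by
  have hC : Cblock n t ^ 2 ≠ 0 := pow_ne_zero 2 (Cblock_pos n ht).ne'
  have h := ((hasDerivAt_Ablock n t).mul (hasDerivAt_Bblock n t)).div ((hasDerivAt_Cblock n t).pow 2) hC
  refine h.congr_deriv ?_
  simp only [Gd, Pi.mul_apply, Pi.pow_apply, Nat.cast_ofNat, Nat.add_one_sub_one, pow_one]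

/-- **The derivative of `R_n`** at `t > 0`: `R_n' = (−1)ⁿ(2G_n² + 2(2t+n)G_nG_n')`.
[cite: Zudilin2003WellPoised, §2 eq. (11)] -/
theorem hasDerivAt_R (n : ℕ) {t : ℝ} (ht : 0 < t) : HasDerivAt (R n) (Rd n t) t := by
  have hR : R n = fun t => (-1) ^ n * ((2 * t + n) * Gblock n t ^ 2) := by
    funext t; rw [R_eq_G]; ring
  have h1 : HasDerivAt (fun t : ℝ => 2 * t + n) 2 t := by
    simpa using ((hasDerivAt_id t).const_mul (2 : ℝ)).add_const (n : ℝ)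
  have h2 := (h1.mul ((hasDerivAt_Gblock n ht).pow 2)).const_mul ((-1 : ℝ) ^ n)
  rw [hR]
  refine h2.congr_deriv ?_
  simp only [Rd, Pi.pow_apply, Nat.cast_ofNat, Nat.add_one_sub_one, pow_one]

/-- `deriv R_n = Rd` at `t > 0`. [cite: Zudilin2003WellPoised, §2 eq. (11)] -/
theorem deriv_R_eq (n : ℕ) {t : ℝ} (ht : 0 < t) : deriv (R n) t = Rd n t := (hasDerivAt_R n ht).deriv

/-! ### The double zeros at `t = 1, …, n` -/

/-- `A_n(k) = 0` for integers `1 ≤ k ≤ n`. [cite: Zudilin2003WellPoised, §2 (proof of Lemma 3: "second-order zero")] -/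
theorem Ablock_natCast_eq_zero (n k : ℕ) (hk1 : 1 ≤ k) (hkn : k ≤ n) : Ablock n (k : ℝ) = 0 := by
  unfold Ablock
  refine prod_eq_zero (i := k - 1) (mem_range.mpr (by omega)) ?_
  rw [show ((k - 1 : ℕ) : ℝ) = (k : ℝ) - 1 by rw [Nat.cast_sub hk1]; simp]
  ring

/-- `G_n(k) = 0` for integers `1 ≤ k ≤ n`. [cite: Zudilin2003WellPoised, §2 (proof of Lemma 3)] -/
theorem Gblock_natCast_eq_zero (n k : ℕ) (hk1 : 1 ≤ k) (hkn : k ≤ n) : Gblock n (k : ℝ) = 0 := by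
  simp [Gblock, Ablock_natCast_eq_zero n k hk1 hkn]

/-- `R_n(k) = 0` for integers `1 ≤ k ≤ n`. [cite: Zudilin2003WellPoised, §2 (proof of Lemma 3)] -/
theorem R_natCast_eq_zero (n k : ℕ) (hk1 : 1 ≤ k) (hkn : k ≤ n) : R n (k : ℝ) = 0 := by
  simp [R_eq_G, Gblock_natCast_eq_zero n k hk1 hkn]

/-- `Rd_n(k) = 0` for integers `1 ≤ k ≤ n`. [cite: Zudilin2003WellPoised, §2 (proof of Lemma 3)] -/
theorem Rd_natCast_eq_zero (n k : ℕ) (hk1 : 1 ≤ k) (hkn : k ≤ n) : Rd n (k : ℝ) = 0 := by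
  simp [Rd, Gblock_natCast_eq_zero n k hk1 hkn]

/-- **`R_n'(k) = 0` for integers `1 ≤ k ≤ n`** (double zeros). [cite: Zudilin2003WellPoised, §2 (proof of Lemma 3)] -/
theorem deriv_R_natCast_eq_zero (n k : ℕ) (hk1 : 1 ≤ k) (hkn : k ≤ n) : deriv (R n) (k : ℝ) = 0 := by
  rw [deriv_R_eq n (Nat.cast_pos.mpr (by omega)), Rd_natCast_eq_zero n k hk1 hkn]

/-! ### Positivity and the factorised derivatives for `t ≥ n+1` -/

/-- `A_n(t) > 0` for `t > n`. [cite: Zudilin2003WellPoised, §2 eq. (10)] -/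
theorem Ablock_pos (n : ℕ) {t : ℝ} (ht : (n : ℝ) < t) : 0 < Ablock n t := by
  unfold Ablock
  refine prod_pos fun j hj => ?_
  have : (j : ℝ) + 1 ≤ n := by exact_mod_cast Nat.succ_le_of_lt (mem_range.mp hj)
  linarith

/-- `B_n(t) > 0` for `t > 0`. [cite: Zudilin2003WellPoised, §2 eq. (10)] -/
theorem Bblock_pos (n : ℕ) {t : ℝ} (ht : 0 < t) : 0 < Bblock n t := by
  unfold Bblock
  exact prod_pos fun j _ => by positivity

/-- `G_n(t) > 0` for `t > n`. [cite: Zudilin2003WellPoised, §2 eq. (10)] -/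
theorem Gblock_pos (n : ℕ) {t : ℝ} (ht : (n : ℝ) < t) : 0 < Gblock n t := by
  have ht0 : 0 < t := lt_of_le_of_lt (Nat.cast_nonneg n) ht
  unfold Gblock
  exact div_pos (mul_pos (Ablock_pos n ht) (Bblock_pos n ht0)) (pow_pos (Cblock_pos n ht0) 2)

/-- Product over one omitted factor = product divided by that factor. [folklore] -/
private theorem prod_erase_eq_mul_one_div (u : Finset ℕ) (f : ℕ → ℝ) {i : ℕ} (hi : i ∈ u) (hfi : f i ≠ 0) :
    ∏ j ∈ u.erase i, f j = (∏ j ∈ u, f j) * (1 / f i) := by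
  rw [mul_one_div, eq_div_iff hfi, ← mul_prod_erase u f hi, mul_comm]

/-- `A_n' = A_n · Σ_i 1/(t−i−1)` for `t > n`. [cite: Zudilin2003WellPoised, §2 eq. (11)] -/
theorem Ad_eq (n : ℕ) {t : ℝ} (ht : (n : ℝ) < t) :
    Ad n t = Ablock n t * ∑ i ∈ range n, 1 / (t - ((i : ℝ) + 1)) := by
  unfold Ad Ablock
  rw [mul_sum]
  refine sum_congr rfl fun i hi => ?_
  refine prod_erase_eq_mul_one_div _ _ hi ?_
  have : (i : ℝ) + 1 ≤ n := by exact_mod_cast Nat.succ_le_of_lt (mem_range.mp hi)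
  exact (sub_pos.mpr (by linarith)).ne'

/-- `B_n' = B_n · Σ_i 1/(t+n+i+1)` for `t > 0`. [cite: Zudilin2003WellPoised, §2 eq. (11)] -/
theorem Bd_eq (n : ℕ) {t : ℝ} (ht : 0 < t) :
    Bd n t = Bblock n t * ∑ i ∈ range n, 1 / (t + n + ((i : ℝ) + 1)) := by
  unfold Bd Bblock
  rw [mul_sum]
  refine sum_congr rfl fun i hi => ?_
  exact prod_erase_eq_mul_one_div _ _ hi (by positivity)

/-- `C_n' = C_n · Σ_i 1/(t+i)` for `t > 0`. [cite: Zudilin2003WellPoised, §2 eq. (11)] -/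
theorem Cd_eq (n : ℕ) {t : ℝ} (ht : 0 < t) :
    Cd n t = Cblock n t * ∑ i ∈ range (n + 1), 1 / (t + (i : ℝ)) := by
  unfold Cd Cblock
  rw [mul_sum]
  refine sum_congr rfl fun i hi => ?_
  exact prod_erase_eq_mul_one_div _ _ hi (by positivity)

/-- **Logarithmic derivative of `G_n`** for `t > n`:
`G_n' = G_n·(Σ_i 1/(t−i−1) + Σ_i 1/(t+n+i+1) − 2Σ_i 1/(t+i))`. [cite: Zudilin2003WellPoised, §2 eq. (11)] -/
theorem Gd_eq (n : ℕ) {t : ℝ} (ht : (n : ℝ) < t) :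
    Gd n t = Gblock n t * (∑ i ∈ range n, 1 / (t - ((i : ℝ) + 1)) +
      ∑ i ∈ range n, 1 / (t + n + ((i : ℝ) + 1)) - 2 * ∑ i ∈ range (n + 1), 1 / (t + (i : ℝ))) := by
  have ht0 : 0 < t := lt_of_le_of_lt (Nat.cast_nonneg n) ht
  have hC : Cblock n t ≠ 0 := (Cblock_pos n ht0).ne'
  unfold Gd Gblock
  rw [Ad_eq n ht, Bd_eq n ht0, Cd_eq n ht0]
  field_simp

/-! ### Bounds for `t ≥ n + 1` -/

/-- `Σ_{i<n} 1/(t−i−1) ≤ n/(t−n)` for `t > n`. [folklore] -/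
private theorem sumA_le (n : ℕ) {t : ℝ} (ht : (n : ℝ) < t) :
    ∑ i ∈ range n, 1 / (t - ((i : ℝ) + 1)) ≤ n / (t - n) := by
  have h : ∀ i ∈ range n, 1 / (t - ((i : ℝ) + 1)) ≤ 1 / (t - n) := by
    intro i hi
    have hi' : (i : ℝ) + 1 ≤ n := by exact_mod_cast Nat.succ_le_of_lt (mem_range.mp hi)
    exact one_div_le_one_div_of_le (by linarith) (by linarith)
  calc ∑ i ∈ range n, 1 / (t - ((i : ℝ) + 1)) ≤ ∑ _i ∈ range n, 1 / (t - n) := sum_le_sum h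
    _ = n / (t - n) := by rw [sum_const, card_range, nsmul_eq_mul]; ring

/-- `0 ≤ Σ_{i<n} 1/(t−i−1)` for `t > n`. [folklore] -/
private theorem sumA_nonneg (n : ℕ) {t : ℝ} (ht : (n : ℝ) < t) :
    0 ≤ ∑ i ∈ range n, 1 / (t - ((i : ℝ) + 1)) := by
  refine sum_nonneg fun i hi => ?_
  have hi' : (i : ℝ) + 1 ≤ n := by exact_mod_cast Nat.succ_le_of_lt (mem_range.mp hi)
  have : 0 < t - ((i : ℝ) + 1) := by linarith
  exact (one_div_pos.mpr this).le

/-- `Σ_{i<n} 1/(t+n+i+1) ≤ n/t` for `t > 0`. [folklore] -/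
private theorem sumB_le (n : ℕ) {t : ℝ} (ht : 0 < t) :
    ∑ i ∈ range n, 1 / (t + n + ((i : ℝ) + 1)) ≤ n / t := by
  have h : ∀ i ∈ range n, 1 / (t + n + ((i : ℝ) + 1)) ≤ 1 / t := fun i _ =>
    one_div_le_one_div_of_le ht
      (by have : (0:ℝ) ≤ n := Nat.cast_nonneg n; have : (0:ℝ) ≤ i := Nat.cast_nonneg i; linarith)
  calc ∑ i ∈ range n, 1 / (t + n + ((i : ℝ) + 1)) ≤ ∑ _i ∈ range n, 1 / t := sum_le_sum h
    _ = n / t := by rw [sum_const, card_range, nsmul_eq_mul]; ring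

/-- `Σ_{i≤n} 1/(t+i) ≤ (n+1)/t` for `t > 0`. [folklore] -/
private theorem sumC_le (n : ℕ) {t : ℝ} (ht : 0 < t) :
    ∑ i ∈ range (n + 1), 1 / (t + (i : ℝ)) ≤ ((n : ℝ) + 1) / t := by
  have h : ∀ i ∈ range (n + 1), 1 / (t + (i : ℝ)) ≤ 1 / t := fun i _ =>
    one_div_le_one_div_of_le ht (by have : (0:ℝ) ≤ i := Nat.cast_nonneg i; linarith)
  calc ∑ i ∈ range (n + 1), 1 / (t + (i : ℝ)) ≤ ∑ _i ∈ range (n + 1), 1 / t := sum_le_sum h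
    _ = ((n : ℝ) + 1) / t := by rw [sum_const, card_range, nsmul_eq_mul]; push_cast; ring

/-- **`|G_n'(t)| ≤ G_n(t)·(4n+2)/(t−n)` for `t ≥ n+1`.** [cite: Zudilin2003WellPoised, §2 (proof of Lemma 3, "R_n(t) = O(t⁻³)")] -/
theorem abs_Gd_le (n : ℕ) {t : ℝ} (ht : (n : ℝ) + 1 ≤ t) :
    |Gd n t| ≤ Gblock n t * ((4 * n + 2) / (t - n)) := by
  have hn0 : (0 : ℝ) ≤ n := Nat.cast_nonneg n
  have htn : (n : ℝ) < t := by linarith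
  have ht0 : 0 < t := by linarith
  have hG := Gblock_pos n htn
  rw [Gd_eq n htn, abs_mul, abs_of_pos hG]
  refine mul_le_mul_of_nonneg_left ?_ hG.le
  have hA := sumA_le n htn
  have hA0 := sumA_nonneg n htn
  have hB := sumB_le n ht0
  have hB0 : 0 ≤ ∑ i ∈ range n, 1 / (t + n + ((i : ℝ) + 1)) :=
    sum_nonneg fun i _ => by positivity
  have hC := sumC_le n ht0
  have hC0 : 0 ≤ ∑ i ∈ range (n + 1), 1 / (t + (i : ℝ)) :=
    sum_nonneg fun i _ => by positivity
  have htn' : 0 < t - n := by linarith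
  -- `n/t ≤ n/(t−n)` and `(n+1)/t ≤ (n+1)/(t−n)`
  have h1 : (n : ℝ) / t ≤ n / (t - n) := div_le_div_of_nonneg_left hn0 htn' (by linarith)
  have h2 : ((n : ℝ) + 1) / t ≤ ((n : ℝ) + 1) / (t - n) :=
    div_le_div_of_nonneg_left (by positivity) htn' (by linarith)
  have hq0 : 0 ≤ (n : ℝ) / (t - n) := by positivity
  have e : (4 * (n : ℝ) + 2) / (t - n) = n / (t - n) + n / (t - n) + 2 * (((n : ℝ) + 1) / (t - n)) := by
    field_simp; ring
  rw [abs_le]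
  constructor
  · linarith
  · linarith

/-- The pairing inequality `(t−a)(t+n+a) ≤ (t+a)(t+n+1−a)` (`a = j+1`, `t ≥ 0`): the difference is `t + a(2n+1)`.
[folklore] -/
private theorem pair_le (n j : ℕ) {t : ℝ} (ht : 0 ≤ t) :
    (t - ((j : ℝ) + 1)) * (t + n + ((j : ℝ) + 1)) ≤ (t + ((j : ℝ) + 1)) * (t + ((n : ℝ) - j)) := by
  have hj : (0 : ℝ) ≤ j := Nat.cast_nonneg j
  have hn : (0 : ℝ) ≤ n := Nat.cast_nonneg n
  have e : (t + ((j : ℝ) + 1)) * (t + ((n : ℝ) - j)) - (t - ((j : ℝ) + 1)) * (t + n + ((j : ℝ) + 1)) =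
      t + ((j : ℝ) + 1) * (2 * n + 1) := by ring
  have : 0 ≤ t + ((j : ℝ) + 1) * (2 * n + 1) := by positivity
  linarith

/-- **`G_n(t) ≤ 1/t²` for `t ≥ n+1`** (`A_nB_n ≤ ((t+1)⋯(t+n))²`, `C_n = t·(t+1)⋯(t+n)`).
[cite: Zudilin2003WellPoised, §2 (proof of Lemma 3, "R_n(t) = O(t⁻³)")] -/
theorem Gblock_le (n : ℕ) {t : ℝ} (ht : (n : ℝ) + 1 ≤ t) : Gblock n t ≤ 1 / t ^ 2 := by
  have hn0 : (0 : ℝ) ≤ n := Nat.cast_nonneg n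
  have ht0 : 0 < t := by linarith
  set P : ℝ := ∏ j ∈ range n, (t + ((j : ℝ) + 1)) with hP
  have hPpos : 0 < P := prod_pos fun j _ => by positivity
  -- `C_n = P · t`
  have hC : Cblock n t = P * t := by
    unfold Cblock
    rw [prod_range_succ' (fun j => t + (j : ℝ))]
    push_cast
    simp only [add_zero, hP]
  -- `A_n B_n ≤ P²`
  have hAB : Ablock n t * Bblock n t ≤ P ^ 2 := by
    unfold Ablock Bblock
    rw [← prod_mul_distrib]
    have hle : ∏ j ∈ range n, (t - ((j : ℝ) + 1)) * (t + n + ((j : ℝ) + 1)) ≤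
        ∏ j ∈ range n, (t + ((j : ℝ) + 1)) * (t + ((n : ℝ) - j)) := by
      refine prod_le_prod (fun j hj => ?_) (fun j _ => pair_le n j ht0.le)
      have : (j : ℝ) + 1 ≤ n := by exact_mod_cast Nat.succ_le_of_lt (mem_range.mp hj)
      have h1 : 0 ≤ t - ((j : ℝ) + 1) := by linarith
      positivity
    refine hle.trans (le_of_eq ?_)
    rw [prod_mul_distrib, sq, hP]
    congr 1
    -- `∏_{j<n} (t + (n − j)) = ∏_{j<n} (t + (j + 1))` by reflection
    rw [← prod_range_reflect (fun j => t + ((j : ℝ) + 1)) n]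
    refine prod_congr rfl fun j hj => ?_
    have hj' : j < n := mem_range.mp hj
    rw [Nat.cast_sub (by omega : j ≤ n - 1), Nat.cast_sub (by omega : 1 ≤ n)]
    push_cast
    ring
  unfold Gblock
  rw [hC, div_le_div_iff₀ (by positivity) (by positivity)]
  nlinarith [mul_nonneg (Ablock_pos n (by linarith : (n:ℝ) < t)).le (Bblock_pos n ht0).le]

/-- **`|R_n(t)| ≤ 3/t³` for `t ≥ n+1`** (`|R_n| = (2t+n)G_n² ≤ (2t+n)/t⁴`). The printed `R_n(t) = O(t⁻³)`.
[cite: Zudilin2003WellPoised, §2 (proof of Lemma 3, "R_n(t) = O(t⁻³)")] -/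
theorem abs_R_le (n : ℕ) {t : ℝ} (ht : (n : ℝ) + 1 ≤ t) : |R n t| ≤ 3 / t ^ 3 := by
  have hn0 : (0 : ℝ) ≤ n := Nat.cast_nonneg n
  have ht0 : 0 < t := by linarith
  have hG := Gblock_le n ht
  have hG0 := (Gblock_pos n (by linarith : (n:ℝ) < t)).le
  rw [R_eq_G, abs_mul, abs_mul, abs_pow, abs_pow, abs_neg, abs_one, one_pow, one_mul,
    abs_of_pos (by linarith : 0 < 2 * t + (n : ℝ)), abs_of_nonneg hG0]
  have hG2 : Gblock n t ^ 2 ≤ (1 / t ^ 2) ^ 2 := pow_le_pow_left₀ hG0 hG 2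
  calc (2 * t + n) * Gblock n t ^ 2 ≤ (3 * t) * (1 / t ^ 2) ^ 2 :=
        mul_le_mul (by linarith) hG2 (by positivity) (by positivity)
    _ = 3 / t ^ 3 := by field_simp

/-- **`|R_n'(t)| ≤ 2/t⁴ + 6(4n+2)/(t³(t−n))` for real `t ≥ n+1`.**
[cite: Zudilin2003WellPoised, §2 (proof of Lemma 3, "R_n(t) = O(t⁻³)")] -/
theorem abs_Rd_le (n : ℕ) {t : ℝ} (ht : (n : ℝ) + 1 ≤ t) :
    |Rd n t| ≤ 2 / t ^ 4 + 6 * (4 * n + 2) / (t ^ 3 * (t - n)) := by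
  have hn0 : (0 : ℝ) ≤ n := Nat.cast_nonneg n
  have ht0 : 0 < t := by linarith
  have htn : 0 < t - n := by linarith
  have hG := Gblock_le n ht
  have hGp := Gblock_pos n (by linarith : (n:ℝ) < t)
  have hGd := abs_Gd_le n ht
  have h2t : 0 < 2 * t + (n : ℝ) := by linarith
  unfold Rd
  rw [abs_mul, abs_pow, abs_neg, abs_one, one_pow, one_mul]
  have hG2 : Gblock n t ^ 2 ≤ 1 / t ^ 4 := by
    have := pow_le_pow_left₀ hGp.le hG 2
    calc Gblock n t ^ 2 ≤ (1 / t ^ 2) ^ 2 := this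
      _ = 1 / t ^ 4 := by field_simp
  have hterm2 : |(2 * t + n) * (2 * Gblock n t * Gd n t)| ≤ 6 * (4 * n + 2) / (t ^ 3 * (t - n)) := by
    rw [abs_mul, abs_of_pos h2t, abs_mul, abs_mul, abs_of_pos hGp, abs_two]
    have hK : 0 ≤ (4 * (n : ℝ) + 2) / (t - n) := by positivity
    calc (2 * t + n) * (2 * Gblock n t * |Gd n t|)
        ≤ (3 * t) * (2 * Gblock n t * (Gblock n t * ((4 * n + 2) / (t - n)))) := by
          refine mul_le_mul (by linarith) ?_ (by positivity) (by positivity)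
          exact mul_le_mul_of_nonneg_left hGd (by positivity)
      _ = 6 * t * Gblock n t ^ 2 * ((4 * n + 2) / (t - n)) := by ring
      _ ≤ 6 * t * (1 / t ^ 4) * ((4 * n + 2) / (t - n)) := by
          refine mul_le_mul_of_nonneg_right ?_ hK
          exact mul_le_mul_of_nonneg_left hG2 (by positivity)
      _ = 6 * (4 * n + 2) / (t ^ 3 * (t - n)) := by field_simp
  calc |2 * Gblock n t ^ 2 + (2 * t + n) * (2 * Gblock n t * Gd n t)|
      ≤ |2 * Gblock n t ^ 2| + |(2 * t + n) * (2 * Gblock n t * Gd n t)| := abs_add_le _ _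
    _ ≤ 2 / t ^ 4 + 6 * (4 * n + 2) / (t ^ 3 * (t - n)) := by
        refine add_le_add ?_ hterm2
        rw [abs_of_nonneg (by positivity)]
        calc 2 * Gblock n t ^ 2 ≤ 2 * (1 / t ^ 4) := by linarith
          _ = 2 / t ^ 4 := by ring

/-- **At the integers `t = n+1+m`: `|R_n'(t)| ≤ (24n+14)/(m+1)⁴`.**
[cite: Zudilin2003WellPoised, §2 (proof of Lemma 3, "R_n(t) = O(t⁻³)")] -/
theorem abs_deriv_R_le (n m : ℕ) :
    |deriv (R n) ((n : ℝ) + 1 + m)| ≤ (24 * n + 14) / ((m : ℝ) + 1) ^ 4 := by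
  have hn0 : (0 : ℝ) ≤ n := Nat.cast_nonneg n
  have hm0 : (0 : ℝ) ≤ m := Nat.cast_nonneg m
  have ht : (n : ℝ) + 1 ≤ (n : ℝ) + 1 + m := by linarith
  rw [deriv_R_eq n (by linarith)]
  refine (abs_Rd_le n ht).trans ?_
  have hm1 : (0 : ℝ) < (m : ℝ) + 1 := by positivity
  have e1 : (n : ℝ) + 1 + m - n = (m : ℝ) + 1 := by ring
  rw [e1]
  -- `t ≥ m+1`
  have hle : (m : ℝ) + 1 ≤ (n : ℝ) + 1 + m := by linarith
  have h1 : 2 / ((n : ℝ) + 1 + m) ^ 4 ≤ 2 / ((m : ℝ) + 1) ^ 4 :=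
    div_le_div_of_nonneg_left (by norm_num) (by positivity) (pow_le_pow_left₀ hm1.le hle 4)
  have h2 : 6 * (4 * (n : ℝ) + 2) / (((n : ℝ) + 1 + m) ^ 3 * ((m : ℝ) + 1)) ≤
      6 * (4 * (n : ℝ) + 2) / (((m : ℝ) + 1) ^ 3 * ((m : ℝ) + 1)) :=
    div_le_div_of_nonneg_left (by positivity) (by positivity)
      (mul_le_mul_of_nonneg_right (pow_le_pow_left₀ hm1.le hle 3) hm1.le)
  have e2 : 2 / ((m : ℝ) + 1) ^ 4 + 6 * (4 * (n : ℝ) + 2) / (((m : ℝ) + 1) ^ 3 * ((m : ℝ) + 1)) =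
      (24 * n + 14) / ((m : ℝ) + 1) ^ 4 := by
    field_simp; ring
  linarith

/-! ### The series (11) -/

/-- The terms of (11) vanish for `t ≤ n` and are `O((24n+14)/(t−n)⁴)` beyond: the shifted series is dominated by
`(24n+14)Σ(m+1)⁻⁴`. [cite: Zudilin2003WellPoised, §2 eq. (11)] -/
theorem summable_deriv_R_shift (n : ℕ) :
    Summable (fun m : ℕ => deriv (R n) (((m + n : ℕ) : ℝ) + 1)) := by
  have hb : Summable (fun m : ℕ => (24 * (n : ℝ) + 14) / ((m : ℝ) + 1) ^ 4) := by
    have h := (Real.summable_one_div_nat_pow.mpr (by norm_num : 1 < 4)).mul_left (24 * (n : ℝ) + 14)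
    have h' := (summable_nat_add_iff 1).mpr h
    refine h'.congr fun m => ?_
    push_cast
    ring
  refine Summable.of_norm_bounded hb fun m => ?_
  rw [Real.norm_eq_abs]
  have e : (((m + n : ℕ) : ℝ) + 1) = (n : ℝ) + 1 + m := by push_cast; ring
  rw [e]
  exact abs_deriv_R_le n m

/-- **The series (11) converges absolutely.** [cite: Zudilin2003WellPoised, §2 eq. (11)] -/
theorem summable_deriv_R (n : ℕ) : Summable (fun m : ℕ => deriv (R n) ((m : ℝ) + 1)) := by
  exact (summable_nat_add_iff n).mp (summable_deriv_R_shift n)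

/-- **`F_n = −Σ_{t≥1} R_n'(t)` as a `HasSum`.** [cite: Zudilin2003WellPoised, §2 eq. (11)] -/
theorem hasSum_F (n : ℕ) : HasSum (fun m : ℕ => -deriv (R n) ((m : ℝ) + 1)) (F n) := by
  unfold F
  rw [← tsum_neg]
  exact (summable_deriv_R n).neg.hasSum

/-- `Σ_{m≥0} (m+1)⁻⁴ = ζ(4) = π⁴/90`. [folklore] -/
private theorem hasSum_inv_succ_pow_four :
    HasSum (fun m : ℕ => 1 / ((m : ℝ) + 1) ^ 4) (Real.pi ^ 4 / 90) := by
  have h := hasSum_zeta_four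
  have h2 := (hasSum_nat_add_iff' 1).mpr h
  simp only [sum_range_one, Nat.cast_zero, ne_eq, OfNat.ofNat_ne_zero, not_false_eq_true, zero_pow,
    div_zero, sub_zero] at h2
  refine h2.congr_fun fun m => ?_
  simp only [Nat.cast_add, Nat.cast_one]

/-- **`|F_n| ≤ 72n + 42`** (from `|R_n'(n+1+m)| ≤ (24n+14)/(m+1)⁴`, the vanishing of `R_n'` at `1, …, n`, and
`Σ(m+1)⁻⁴ = π⁴/90 < 3`): a polynomial bound, against the geometric growth `u_n ≥ 12ⁿ` of the coefficients.
[cite: Zudilin2003WellPoised, §2 eq. (11) and Theorem 1 (7)] -/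
theorem abs_F_le (n : ℕ) : |F n| ≤ 72 * n + 42 := by
  have hn0 : (0 : ℝ) ≤ n := Nat.cast_nonneg n
  -- `F n = -(Σ_{m<n} a m) - Σ' a (m+n)` with the first block zero
  have hs := summable_deriv_R n
  have hsplit := (hs.sum_add_tsum_nat_add n).symm
  have hzero : ∑ m ∈ range n, deriv (R n) ((m : ℝ) + 1) = 0 := by
    refine sum_eq_zero fun m hm => ?_
    have := deriv_R_natCast_eq_zero n (m + 1) (by omega) (by have := mem_range.mp hm; omega)
    push_cast at this
    exact this
  rw [hzero, zero_add] at hsplit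
  have hF : F n = -∑' m : ℕ, deriv (R n) (((m + n : ℕ) : ℝ) + 1) := by
    unfold F; rw [hsplit]
  -- bound the shifted tsum termwise
  have hb : HasSum (fun m : ℕ => (24 * (n : ℝ) + 14) / ((m : ℝ) + 1) ^ 4)
      ((24 * (n : ℝ) + 14) * (Real.pi ^ 4 / 90)) := by
    have := hasSum_inv_succ_pow_four.mul_left (24 * (n : ℝ) + 14)
    refine this.congr_fun fun m => ?_
    ring
  have hle : ∀ m : ℕ, ‖deriv (R n) (((m + n : ℕ) : ℝ) + 1)‖ ≤ (24 * (n : ℝ) + 14) / ((m : ℝ) + 1) ^ 4 := by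
    intro m
    rw [Real.norm_eq_abs]
    have e : (((m + n : ℕ) : ℝ) + 1) = (n : ℝ) + 1 + m := by push_cast; ring
    rw [e]
    exact abs_deriv_R_le n m
  have htsum : ‖∑' m : ℕ, deriv (R n) (((m + n : ℕ) : ℝ) + 1)‖ ≤ (24 * (n : ℝ) + 14) * (Real.pi ^ 4 / 90) :=
    tsum_of_norm_bounded hb hle
  rw [Real.norm_eq_abs] at htsum
  rw [hF, abs_neg]
  refine htsum.trans ?_
  have hpi : Real.pi ^ 4 / 90 < 3 := by
    have h4 := Real.pi_lt_four
    have h0 := Real.pi_pos.le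
    have : Real.pi ^ 4 < 4 ^ 4 := pow_lt_pow_left₀ h4 h0 (by norm_num)
    nlinarith
  nlinarith

end Literature.NumberTheory.Irrationality.Zudilin2003.ZetaFour

end
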